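import Mathlib
import HarnessLib
import Summits.Langlands.Langlands.Theorems.ExteriorSquareAscentSelfTwistedIrreducibleDefs
import Literature.NumberTheory.GaloisRepresentations.PowLocallyAlgebraicProofs
import Literature.NumberTheory.GaloisRepresentations.WeakAbelianDirectSummand
import Literature.NumberTheory.GaloisRepresentations.ModNCyclotomicCharacter
import Literature.NumberTheory.GaloisRepresentations.IntegralGaloisActionProofs
import Literature.NumberTheory.Automorphic.ReciprocityGLn
import Literature.NumberTheory.Automorphic.GaloisActionPlaces

/-!
# Crux `SelfTwistedIrreducible` (stmt-Langlands-18055), line `Sketch`: stub `stub_doubledDetIsHecke`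

Shape (B) of the line (idea det-pinning): over the quadratic `L/K` with non-trivial automorphism
`τ`, let `f` be cuspidal on `GL₂/L` and `ρ' : Γ_L → GL₄(ℚ̄_ℓ)` be `E`-rational a.e.
(`IsRationalAE ρ'`), compatible with `f ⊞ f^τ` (`IsCompatibleAlong τ f ι ρ'`) and *doubled*
(`IsDoubled ρ'`: `charpoly ρ'(σ) = (charpoly W(σ))²` for a continuous `W : Γ_L → GL₂(ℚ̄_ℓ)`).
Then the determinant `det W` is the `ℓ`-adic avatar of an algebraic Hecke character `χ` of `L`
which pins the doubling: a.e. `t_{f,w} ⊔ t_{f,τw} = {x, x, y, y}` and `χ(ϖ_w) = q_w³ · x y`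
(`HasPinnedDoubling τ f χ`).

Proof.  The rank-one framed representation `δ := det W` is semisimple, unramified wherever `ρ'`
is (`(charpoly W σ)² = (X - 1)⁴` forces `charpoly W σ = (X - 1)²`, monic square roots being
unique, hence `det W σ = 1`), and `E`-rational: if `(X² - tX + d)² = R ∈ e(E)[X]` then
`d = e((r₂ - r₃²/4)/2)` (square-root descent in degree two, characteristic zero).  It weakly
divides itself, so the tree's PROVED Böckle–Hui theorem
(`exists_heckeCharacter_of_weaklyDivides_holds`, rank one) produces an algebraic Hecke character
`χ` with `det W(Frob_w) = ι⁻¹(χ(ϖ_w))⁻¹` a.e.  At a good place, with `Φ` a Frobenius,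
`arithFrobPolyOfSatake ι q_w 4 (β + β') = (charpoly W Φ)²`; writing `charpoly W Φ = (X - u)(X - v)`
in the algebraically closed `ℚ̄_ℓ` and comparing roots (`a ↦ ι⁻¹((√q)³ a)⁻¹` is injective) gives
`β + β' = {x, x, y, y}` and `χ(ϖ_w) = ((√q)³ x)((√q)³ y) = q³ x y`.

References: BockleHui2025 Thm 1.1 (tree, proved); Shavali2026 = arXiv:2603.19768 Cor. 4.6.
-/

noncomputable section

namespace Summit.Langlands.Langlands.Cruxes.SelfTwistedIrreducible.DetPinning

open scoped NumberField Polynomial Classical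
open Filter Polynomial NumberField IsDedekindDomain Field
open Literature.NumberTheory.GaloisRepresentations Literature.NumberTheory.Automorphic

/-! ### Polynomial lemmas -/

/-- Monic polynomials over a domain with equal squares are equal. [folklore] -/
theorem monic_eq_of_sq_eq_sq {R : Type*} [CommRing R] [IsDomain R] {A B : R[X]}
    (hA : A.Monic) (hB : B.Monic) (h : A ^ 2 = B ^ 2) : A = B := by
  rcases sq_eq_sq_iff_eq_or_eq_neg.mp h with h | h
  · exact h
  · have h1 : (1 : R) = -1 := by
      have := congrArg Polynomial.leadingCoeff h
      rwa [leadingCoeff_neg, hA.leadingCoeff, hB.leadingCoeff] at this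
    calc A = C (-1) * B := by rw [h, C_neg, C_1, neg_one_mul]
      _ = B := by rw [← h1, C_1, one_mul]

/-- Square-root descent in degree two (characteristic zero): if `(X² - tX + d)² = R ∈ e(E)[X]`
then `d = e((r₂ - r₃²/4)/2)`. [folklore] -/
theorem eq_map_of_sq_eq_map {k E : Type*} [Field k] [CharZero k] [Field E] (e : E →+* k)
    (t d : k) (R : E[X]) (h : (X ^ 2 - C t * X + C d) ^ 2 = R.map e) :
    d = e ((R.coeff 2 - R.coeff 3 ^ 2 / 4) / 2) := by
  have hexp : (X ^ 2 - C t * X + C d : k[X]) ^ 2 =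
      X ^ 4 + C (-(2 * t)) * X ^ 3 + C (t ^ 2 + 2 * d) * X ^ 2 + C (-(2 * t * d)) * X +
        C (d ^ 2) := by
    simp only [map_neg, map_mul, map_add, map_pow, map_ofNat]
    ring
  have h3 : e (R.coeff 3) = -(2 * t) := by
    have := congrArg (Polynomial.coeff · 3) h
    simp only [hexp, coeff_map, coeff_add, coeff_C_mul_X_pow, coeff_C_mul_X, coeff_C,
      coeff_X_pow] at this
    simpa using this.symm
  have h2 : e (R.coeff 2) = t ^ 2 + 2 * d := by
    have := congrArg (Polynomial.coeff · 2) h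
    simp only [hexp, coeff_map, coeff_add, coeff_C_mul_X_pow, coeff_C_mul_X, coeff_C,
      coeff_X_pow] at this
    simpa using this.symm
  rw [map_div₀, map_sub, map_div₀, map_pow, h3, h2, map_ofNat, map_ofNat]
  ring

/-- Pinning from a doubled Frobenius polynomial: if `arithFrobPolyOfSatake ι q 4 α = (charpoly M)²`
for a `2 × 2` matrix `M` over `ℚ̄_ℓ` (`q ≥ 1`), then `α = {x, x, y, y}` with
`(ι (det M))⁻¹ = q³ · x y`. [folklore] -/
theorem exists_pair_of_arithFrobPolyOfSatake_eq_sq {ℓ : ℕ} [Fact ℓ.Prime]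
    (ι : PadicAlgCl ℓ ≃+* ℂ) {q : ℕ} (hq : q ≠ 0) (α : Multiset ℂ)
    (M : Matrix (Fin 2) (Fin 2) (PadicAlgCl ℓ))
    (h : arithFrobPolyOfSatake ι q 4 α = M.charpoly ^ 2) :
    ∃ x y : ℂ, α = {x, x, y, y} ∧ (ι M.det)⁻¹ = (q : ℂ) ^ 3 * (x * y) := by
  -- roots of the monic quadratic `M.charpoly` in the algebraically closed field `ℚ̄_ℓ`
  have hmon : M.charpoly.Monic := Matrix.charpoly_monic M
  have hspl : M.charpoly.Splits := IsAlgClosed.splits M.charpoly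
  obtain ⟨u, v, huv⟩ : ∃ u v, M.charpoly.roots = {u, v} :=
    Multiset.card_eq_two.mp
      (by rw [← hspl.natDegree_eq_card_roots, Matrix.charpoly_natDegree_eq_dim, Fintype.card_fin])
  have hprod : M.charpoly = (X - C u) * (X - C v) := by
    have := hspl.eq_prod_roots_of_monic hmon
    rw [huv] at this
    simpa using this
  have hdet : M.det = u * v := by
    rw [Matrix.det_eq_sign_charpoly_coeff, Fintype.card_fin, hprod, coeff_zero_eq_eval_zero]
    simp only [eval_mul, eval_sub, eval_X, eval_C]
    ring
  -- the scaling map `a ↦ ι⁻¹((√q)³ a)⁻¹` and its injectivity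
  obtain ⟨c, hc⟩ : ∃ c : ℂ, c = ((Real.sqrt q : ℝ) : ℂ) ^ (4 - 1) := ⟨_, rfl⟩
  have hc0 : c ≠ 0 := by
    rw [hc]
    refine pow_ne_zero _ ?_
    rw [Complex.ofReal_ne_zero]
    exact Real.sqrt_ne_zero'.mpr (by exact_mod_cast Nat.pos_of_ne_zero hq)
  obtain ⟨g, hg⟩ : ∃ g : ℂ → PadicAlgCl ℓ, ∀ a, g a = ι.symm (c * a)⁻¹ := ⟨_, fun _ => rfl⟩
  have hginj : Function.Injective g := by
    intro a b hab
    rw [hg, hg] at hab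
    exact mul_left_cancel₀ hc0 (inv_injective (ι.symm.injective hab))
  have h22 : (2 • ({u, v} : Multiset (PadicAlgCl ℓ))) = {u, u, v, v} := by
    simp only [two_nsmul, Multiset.insert_eq_cons, Multiset.cons_add, Multiset.add_cons,
      Multiset.singleton_add]
  have hroots : α.map g = {u, u, v, v} := by
    rw [← h22, ← huv, ← roots_pow, ← h, roots_arithFrobPolyOfSatake]
    congr 1
    funext a
    rw [hg, hc]
  obtain ⟨x, -, hx⟩ : ∃ x ∈ α, g x = u := Multiset.mem_map.mp (by rw [hroots]; simp)
  obtain ⟨y, -, hy⟩ : ∃ y ∈ α, g y = v := Multiset.mem_map.mp (by rw [hroots]; simp)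
  refine ⟨x, y, Multiset.map_injective hginj ?_, ?_⟩
  · rw [hroots]
    simp [hx, hy]
  · have hu : (ι u)⁻¹ = c * x := by rw [← hx, hg, RingEquiv.apply_symm_apply, inv_inv]
    have hv : (ι v)⁻¹ = c * y := by rw [← hy, hg, RingEquiv.apply_symm_apply, inv_inv]
    have hc2 : c * c = (q : ℂ) ^ 3 := by
      rw [hc, ← pow_add, show (4 - 1 + (4 - 1) : ℕ) = 2 * 3 by norm_num, pow_mul,
        ← Complex.ofReal_pow, Real.sq_sqrt (Nat.cast_nonneg _), Complex.ofReal_natCast]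
    rw [hdet, map_mul, mul_inv, hu, hv, ← hc2]
    ring

/-! ### The stub -/

/-- **Stub 5 of line `Sketch` (the doubled determinant is a Hecke character, pinned).**  If
`ρ' : Γ_L → GL₄(ℚ̄_ℓ)` is `E`-rational a.e., compatible with `f ⊞ f^τ` and doubled by
`W : Γ_L → GL₂(ℚ̄_ℓ)`, then `det W` is the `ℓ`-adic avatar of an algebraic Hecke character `χ`
of `L` (rank-one Böckle–Hui, `exists_heckeCharacter_of_weaklyDivides_holds`, applied to the
`E`-rational semisimple `δ = det W` weakly dividing itself), and `χ` pins the doubling: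
`t_{f,w} ⊔ t_{f,τw} = {x, x, y, y}` with `χ(ϖ_w) = q_w³ x y` at almost every `w`. [folklore] -/
theorem stub_doubledDetIsHecke :
    ∀ (K : Type) [Field K] [NumberField K] (L : Type) [Field L] [NumberField L] [Algebra K L]
      (τ : L ≃ₐ[K] L), τ ≠ 1 → Module.finrank K L = 2 →
      ∀ (hL2 : isCompact_glFiniteIntegralLevel 2 L) (f : CuspidalAutomorphicRepData 2 L hL2)
        (ℓ : ℕ) [Fact ℓ.Prime] (ι : PadicAlgCl ℓ ≃+* ℂ) (ρ' : FramedGaloisRep L (PadicAlgCl ℓ) 4),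
        IsRationalAE ρ' → IsCompatibleAlong τ f ι ρ' → IsDoubled ρ' →
          ∃ χ : HeckeCharacter L, HasPinnedDoubling τ f χ := by
  intro K _ _ L _ _ _ τ _ _ hL2 f ℓ _ ι ρ' hrat hcomp hdbl
  obtain ⟨E, _, _, e, hE⟩ := hrat
  obtain ⟨W, hW⟩ := hdbl
  -- the determinant of `W` as a rank-one framed representation
  set δ : FramedGaloisRep L (PadicAlgCl ℓ) 1 := FramedRep.ofCharacter (FramedRep.det W) with hδ
  have hss : δ.toGaloisRep.IsSemisimple := FramedRep.isSemisimple_of_rank_one δ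
  -- `δ` is unramified wherever `ρ'` is
  have hunr : ∀ w, ρ'.IsUnramifiedAt w → δ.IsUnramifiedAt w := by
    intro w hw 𝔓 h𝔓 σ hσ
    have h1 : ρ' σ = 1 := hw 𝔓 h𝔓 σ hσ
    have h2 : (W σ).val.charpoly = (X - 1) ^ 2 := by
      have h := hW σ
      rw [h1, Units.val_one, Matrix.charpoly_one, Fintype.card_fin,
        show ((X : (PadicAlgCl ℓ)[X]) - 1) ^ 4 = ((X - 1) ^ 2) ^ 2 by ring] at h
      refine monic_eq_of_sq_eq_sq (Matrix.charpoly_monic _) ?_ h.symm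
      simpa using (monic_X_sub_C (1 : PadicAlgCl ℓ)).pow 2
    have h3 : (W σ).val.det = 1 := by
      rw [Matrix.det_eq_sign_charpoly_coeff, Fintype.card_fin, h2, coeff_zero_eq_eval_zero]
      norm_num
    have h4 : FramedRep.det W σ = 1 := Units.ext (by
      rw [FramedRep.det_apply, Matrix.GeneralLinearGroup.val_det_apply, h3, Units.val_one])
    rw [hδ]
    refine Units.ext (Matrix.ext fun i j => ?_)
    rw [FramedRep.ofCharacter_apply_coe, h4, Units.val_one, Units.val_one, Subsingleton.elim i j,
      Matrix.one_apply_eq]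
  -- `δ` is `E`-rational (square-root descent)
  have hratδ : δ.IsRationalOver e := by
    refine hE.mono fun w hw => ?_
    obtain ⟨hw, R, hR⟩ := hw
    refine ⟨hunr w hw, X - C ((R.coeff 2 - R.coeff 3 ^ 2 / 4) / 2), ?_⟩
    intro 𝔓 h𝔓 σ hσ
    rw [Polynomial.map_sub, map_X, map_C, hδ, FramedRep.charpoly_ofCharacter, FramedRep.det_apply,
      Matrix.GeneralLinearGroup.val_det_apply]
    congr 2
    have h := (hR 𝔓 h𝔓 σ hσ).symm.trans (hW σ)
    rw [Matrix.charpoly_fin_two] at h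
    exact eq_map_of_sq_eq_map e _ _ R h.symm
  -- `δ` weakly divides itself; Böckle–Hui in rank one
  have hwd : δ.WeaklyDivides δ :=
    FramedGaloisRep.WeaklyDivides.of_eventually
      (hratδ.mono fun w hw => ⟨hw.1, hw.1, fun _ _ σ _ => dvd_rfl⟩)
  obtain ⟨χ, -, hχ⟩ := exists_heckeCharacter_of_weaklyDivides_holds L ℓ 1 E e δ hss hratδ δ hwd ι
  refine ⟨χ, ?_⟩
  -- pinning at almost every place
  filter_upwards [hcomp, hχ] with w hw1 hw2
  intro β β' hβ hβ'
  obtain ⟨-, hF⟩ := hw1 β β' hβ hβ'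
  obtain ⟨-, -, hδF⟩ := hw2
  obtain ⟨𝔓, h𝔓⟩ := HeightOneSpectrum.primesAbove_nonempty w
  obtain ⟨Φ, hΦ⟩ := HeightOneSpectrum.exists_isArithFrobAt_of_mem_primesAbove_holds h𝔓
  have h1 : arithFrobPolyOfSatake ι w.residueCard 4 (β + β') = (W Φ).val.charpoly ^ 2 :=
    (hF 𝔓 h𝔓 Φ hΦ).symm.trans (hW Φ)
  have h2 : (W Φ).val.det = ι.symm (χ.valueAtUniformizer w)⁻¹ := by
    have h := hδF 𝔓 h𝔓 Φ hΦ
    rw [hδ, FramedRep.charpoly_ofCharacter, sub_right_inj, C_inj, FramedRep.det_apply,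
      Matrix.GeneralLinearGroup.val_det_apply] at h
    exact h
  obtain ⟨x, y, hxy, hval⟩ := exists_pair_of_arithFrobPolyOfSatake_eq_sq ι
    (HeightOneSpectrum.one_lt_residueCard w).ne_bot (β + β') _ h1
  refine ⟨x, y, hxy, ?_⟩
  rw [h2, RingEquiv.apply_symm_apply, inv_inv] at hval
  exact hval

end Summit.Langlands.Langlands.Cruxes.SelfTwistedIrreducible.DetPinning

end
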